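import Summits.Ventures.HodgeRepro2.PeterssonFundamentalDomain
import Summits.Ventures.HodgeRepro2.BallFundamentalDomainExists
import Summits.Ventures.HodgeRepro2.BallQuotientCovolume

/-!
# The Petersson norm on a compact Picard modular surface is positive definite — final assembly

Kernel support for the blind cell pub-hodge-repro2 (seat p2), T5-ID §ID-4(b′), assembling rows 95–103:
for the Picard data of `Hypothesis.lean` (`H` hermitian, definite away from `τ₁`, a frame `Q`, a lattice
`𝔪`), a TORSION-FREE subgroup `S ⊆ Γ_N` of the Shimura congruence group whose quotient `S\𝔹²` is
COMPACT,

* a measurable fundamental domain `D` of finite Bergman measure exists;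
* the Petersson inner product against the quotient measure `quotientMeasure D` (= the integral over `D`
  of `f \overline{g} (1 − ‖z‖²)^k dμ_B`, independent of `D`) is positive definite on continuous weight-`k`
  forms: `∫_D |f|² (1 − ‖z‖²)^k dμ_B > 0` unless `f ≡ 0` on the ball.

No measure-theoretic hypothesis remains: only the arithmetic input «`S\𝔹²` is compact» (the
anisotropy of `H`) and the torsion-freeness of `S` (neatness, `Neat.lean`), both of which are the
standing hypotheses of the printed theorems instantiated in TIER3.md / TIER5.md.
-/

namespace Summit.Ventures.HodgeRepro2.ShimuraData

open MeasureTheory Complex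

variable {K : Type*} [Field K] [NumberField K] [NumberField.IsCMField K]
    {τ₁ : K →+* ℂ} {H : Matrix (Fin 3) (Fin 3) K}

section Domain

variable {Q : Matrix (Fin 3) (Fin 3) ℂ} {𝔪 : Submodule ℤ (Fin 3 → K)} {N : ℕ} {S : Subgroup (GL (Fin 3) K)}

/-- **A fundamental domain of finite Bergman measure exists** for a torsion-free `S ⊆ Γ_N` with compact
quotient. -/
theorem exists_isBallFundamentalDomain_lt_top (hH : IsHermitianForm K H)
    (hdef : ∀ τ : K →+* ℂ, NumberField.InfinitePlace.mk τ ≠ NumberField.InfinitePlace.mk τ₁ →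
      IsDefiniteAt K τ H)
    (hQ : IsFrame K τ₁ H Q) (h𝔪 : IsLattice K 𝔪)
    (hS : (S : Set (GL (Fin 3) K)) ⊆ shimuraLevel K H 𝔪 N)
    (htf : IsTorsionFreeSet K (S : Set (GL (Fin 3) K)))
    [CompactSpace (ballQuotient hQ S (subset_unitaryGroup_of_subset_shimuraLevel hS))] :
    ∃ D : Set ball₂, MeasurableSet D ∧
      IsBallFundamentalDomain hQ S (subset_unitaryGroup_of_subset_shimuraLevel hS) D ∧
      bergmanBall D < ⊤ := by
  obtain ⟨D, hDm, hD⟩ := exists_isBallFundamentalDomain hH hdef hQ h𝔪 hS htf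
  exact ⟨D, hDm, hD, bergmanBall_lt_top_of_compactSpace hQ S _ hD⟩

end Domain

section Positivity

variable {Q : Matrix (Fin 3) (Fin 3) ℂ} (hQ : IsFrame K τ₁ H Q) (S : Subgroup (GL (Fin 3) K))
    (hS : (S : Set (GL (Fin 3) K)) ⊆ unitaryGroup K H) {D : Set ball₂}

/-- The Petersson norm `∫_{S\𝔹²} |f|² (1 − ‖z‖²)^k` against the quotient measure is the integral over
the fundamental domain. -/
theorem integral_peterssonQuotient_quotientMeasure (D : Set ball₂) {k : ℕ} {f : (Fin 2 → ℂ) → ℂ}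
    (hf : IsWeightFor τ₁ Q S k f) (hfc : ContinuousOn f ball₂) :
    ∫ x, peterssonQuotient hQ S hS hf x ∂quotientMeasure hQ S hS D =
      ∫ z in D, petersson k f (z : Fin 2 → ℂ) ∂bergmanBall := by
  rw [integral_quotientMeasure hQ S hS D
    (continuous_peterssonQuotient hQ S hS hf hfc).aestronglyMeasurable]
  simp only [peterssonQuotient_mk]

/-- **Positivity of the Petersson norm on a compact quotient** (any fundamental domain `D`): for a
continuous weight-`k` form `f` with `f z₀ ≠ 0` at one point of the ball,
`∫_D |f(z)|² (1 − ‖z‖²)^k dμ_B(z) > 0`. -/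
theorem setIntegral_petersson_pos [CompactSpace (ballQuotient hQ S hS)]
    (hD : IsBallFundamentalDomain hQ S hS D) {k : ℕ} {f : (Fin 2 → ℂ) → ℂ}
    (hf : IsWeightFor τ₁ Q S k f) (hfc : ContinuousOn f ball₂) {z₀ : Fin 2 → ℂ} (hz₀ : z₀ ∈ ball₂)
    (hne : f z₀ ≠ 0) : 0 < ∫ z in D, petersson k f (z : Fin 2 → ℂ) ∂bergmanBall := by
  haveI := isOpenPosMeasure_quotientMeasure hQ S hS hD
  haveI := isFiniteMeasure_quotientMeasure_of_compactSpace hQ S hS hD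
  rw [← integral_peterssonQuotient_quotientMeasure hQ S hS D hf hfc]
  exact integral_peterssonQuotient_pos hQ S hS (quotientMeasure hQ S hS D) hf hfc hz₀ hne

/-- **Positive definiteness of the Petersson inner product on a compact quotient** (any fundamental
domain `D`): `⟨f, f⟩ > 0` unless `f ≡ 0` on the ball. -/
theorem peterssonInner_self_re_pos_of_compactSpace [CompactSpace (ballQuotient hQ S hS)]
    (hD : IsBallFundamentalDomain hQ S hS D) {k : ℕ} {f : (Fin 2 → ℂ) → ℂ}
    (hf : IsWeightFor τ₁ Q S k f) (hfc : ContinuousOn f ball₂) {z₀ : Fin 2 → ℂ} (hz₀ : z₀ ∈ ball₂)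
    (hne : f z₀ ≠ 0) :
    0 < (peterssonInner hQ S hS (quotientMeasure hQ S hS D) hf hf).re :=
  peterssonInner_self_re_pos_quotientMeasure hQ S hS hD
    (bergmanBall_lt_top_of_compactSpace hQ S hS hD) hf hfc hz₀ hne

/-- **Non-degeneracy on a compact quotient**: `⟨f, f⟩ = 0 ⟺ f ≡ 0` on the ball. -/
theorem peterssonInner_self_eq_zero_iff_of_compactSpace [CompactSpace (ballQuotient hQ S hS)]
    (hD : IsBallFundamentalDomain hQ S hS D) {k : ℕ} {f : (Fin 2 → ℂ) → ℂ}
    (hf : IsWeightFor τ₁ Q S k f) (hfc : ContinuousOn f ball₂) :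
    peterssonInner hQ S hS (quotientMeasure hQ S hS D) hf hf = 0 ↔ ∀ z ∈ ball₂, f z = 0 :=
  peterssonInner_self_eq_zero_iff_quotientMeasure hQ S hS hD
    (bergmanBall_lt_top_of_compactSpace hQ S hS hD) hf hfc

/-- The Petersson norm over the fundamental domain vanishes iff `f ≡ 0` on the ball. -/
theorem setIntegral_petersson_eq_zero_iff_of_compactSpace [CompactSpace (ballQuotient hQ S hS)]
    (hD : IsBallFundamentalDomain hQ S hS D) {k : ℕ} {f : (Fin 2 → ℂ) → ℂ}
    (hf : IsWeightFor τ₁ Q S k f) (hfc : ContinuousOn f ball₂) :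
    ∫ z in D, petersson k f (z : Fin 2 → ℂ) ∂bergmanBall = 0 ↔ ∀ z ∈ ball₂, f z = 0 := by
  constructor
  · intro h z hz
    by_contra hne
    exact (setIntegral_petersson_pos hQ S hS hD hf hfc hz hne).ne' h
  · intro h0
    rw [← integral_peterssonQuotient_quotientMeasure hQ S hS D hf hfc]
    have : peterssonQuotient hQ S hS hf = 0 := by
      funext x
      obtain ⟨z, rfl⟩ := ballQuotient_mk_surjective hQ S hS x
      rw [peterssonQuotient_mk, Pi.zero_apply]
      unfold petersson
      rw [h0 z z.property, norm_zero, zero_pow two_ne_zero, zero_mul]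
    rw [this]
    exact integral_zero _ _

end Positivity

section Arithmetic

variable {Q : Matrix (Fin 3) (Fin 3) ℂ} {𝔪 : Submodule ℤ (Fin 3 → K)} {N : ℕ} {S : Subgroup (GL (Fin 3) K)}

/-- **The Petersson norm of a non-zero form on a compact Picard modular surface is positive — with the
arithmetic hypotheses only**: `H` hermitian and definite away from `τ₁`, `S ⊆ Γ_N` torsion-free, `S\𝔹²`
compact; then there is a fundamental domain `D` with `∫_D |f|² (1 − ‖z‖²)^k dμ_B > 0` for every
continuous weight-`k` form `f` not vanishing at some point of the ball. -/
theorem exists_fundamentalDomain_setIntegral_petersson_pos (hH : IsHermitianForm K H)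
    (hdef : ∀ τ : K →+* ℂ, NumberField.InfinitePlace.mk τ ≠ NumberField.InfinitePlace.mk τ₁ →
      IsDefiniteAt K τ H)
    (hQ : IsFrame K τ₁ H Q) (h𝔪 : IsLattice K 𝔪)
    (hS : (S : Set (GL (Fin 3) K)) ⊆ shimuraLevel K H 𝔪 N)
    (htf : IsTorsionFreeSet K (S : Set (GL (Fin 3) K)))
    [CompactSpace (ballQuotient hQ S (subset_unitaryGroup_of_subset_shimuraLevel hS))]
    {k : ℕ} {f : (Fin 2 → ℂ) → ℂ}
    (hf : IsWeightFor τ₁ Q S k f) (hfc : ContinuousOn f ball₂) {z₀ : Fin 2 → ℂ} (hz₀ : z₀ ∈ ball₂)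
    (hne : f z₀ ≠ 0) :
    ∃ D : Set ball₂, IsBallFundamentalDomain hQ S (subset_unitaryGroup_of_subset_shimuraLevel hS) D ∧
      0 < ∫ z in D, petersson k f (z : Fin 2 → ℂ) ∂bergmanBall := by
  obtain ⟨D, -, hD, -⟩ := exists_isBallFundamentalDomain_lt_top hH hdef hQ h𝔪 hS htf
  exact ⟨D, hD, setIntegral_petersson_pos hQ S _ hD hf hfc hz₀ hne⟩

end Arithmetic

end Summit.Ventures.HodgeRepro2.ShimuraData
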